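import Literature.NumberTheory.GaloisCohomology.Howard2004.FrobIdealRingChangeProofs
import HarnessLib

/-!
# Descending additive maps to Howard's level quotients; semilinear base change of `I_ℓ`, `I_n`, `𝓛_k`
  (instance-free adapter for tower morphisms `T^{(k)} → T'^{(k)}` over a ring map `φ : R → R'`)

References: [Howard2004HeegnerKolyvagin] B. Howard, *The Heegner point Kolyvagin system*,
Compos. Math. 140 (2004) 1439–1472 (arXiv:1202.6340) — Def. 1.1.3 (the towers `T/IT`, the
category `Quot(T)` and its morphisms; arXiv Def. 2.1.3, p. 5 L93–99), Def. 1.2.1 (`I_ℓ`, `𝓛_k`,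
`I_n`; arXiv p. 6 L63–75), Def. 1.2.3 (Kolyvagin systems and the maps `T^{(k+1)}/I_n → T^{(k)}/I_n`;
arXiv p. 7 L1–12), Rem. 1.2.4 (change of coefficient ring `T ↦ T ⊗_R R/J`; arXiv Rem. 2.2.4,
p. 7 L13–27), and the first sentence of the proof of Thm. 2.2.10 (arXiv Thm. 3.2.10, p. 17
L78–81: «Remark (functoriality) and Lemma (local comparison) yield a map
`KS(𝐓, F_Λ, 𝓛) → KS(T_𝔭, F_𝔭, 𝓛)`»).

## Why this file

`FrobIdealRingChangeProofs` compares `I_ℓ(R, T)` with `I_ℓ(R', T/JT)` under INSTANCE arguments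
`[Algebra R R'] [Module R N] [IsScalarTower R R' N]`.  The tower-morphism structure
`CoeffTowerSetting.Hom φ S S'` (`TowerMorphism.lean`) is instance-free: its level maps
`f k : N k →+ N' k` are bare additive maps with a semilinearity law over an explicit ring map, and
its quotient-level maps `fq k n : Nq k n →+ Nq' k n` are DATA pinned by
`fq_comp : fq k n ∘ π_n = π'_n ∘ f k`.  Whoever instantiates a `Hom` between two towers whose level
rings are unrelated types (e.g. `Λ/J` versus `Λ/(q_m, p^{k+1})`) must CONSTRUCT `fq` and discharge
the level-ideal inclusion `φ(I_n(T)) ⊆ I_n(T')` with no `Algebra`/`Module` instance relating the two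
towers.  This file supplies exactly that, with all instances confined to the proofs:

* §0 pure algebra: an additive `f : M →+ M'` with `f (r • m) = φ r • f m` maps `I•M` into `I'•M'`
  as soon as `I ≤ I'.comap φ` (`mapsTo_smul_top_of_le_comap`), in particular `p^k M` into `p^k M'`
  (`mapsTo_span_pow_smul_top`) and `(ker φ)•M` to `0` (`map_eq_zero_of_mem_ker_smul_top`).
* §1 `IsQuotientBy.descend`: for presentations `π : T ↠ N` of `T/IT` over `R` and `π' : T' ↠ N'` of
  `T'/I'T'` over `R'` and an additive `f : T →+ T'` with `f(IT) ⊆ I'T'`, THE additive map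
  `N →+ N'` with `descend ∘ π = π' ∘ f` (`descend_apply`); it is unique (`descend_unique`,
  `addMonoidHom_ext`), `Γ_K`-equivariant when `f` is (`descend_equivariant`), `φ`-semilinear when
  `f` is (`descend_smul`), equal to `transition` for `f = id` (`descend_id_eq_transition`),
  compatible with the stage transitions `T/IT → T/JT` on both sides (`descend_transition`) and
  with composition (`descend_comp`); the existence criterion `exists_addMonoidHom_iff` («an additive
  map under `π`, `π'` exists iff `f(IT) ⊆ I'T'`»).
* §2 `IsBaseChangeBy ρ φ ρ' f`: the instance-free predicate «the additive surjection `f : T ↠ T'`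
  presents the base change `T' = T ⊗_R R'` along the surjection `φ : R ↠ R'`» (`φ`-semilinear,
  `ker f ⊆ (ker φ)T`, `Γ_K`-equivariant) and, over it, the re-export of `FrobIdealRingChangeProofs`:
  ALWAYS `(I_ℓ(R,T)).map φ ≤ I_ℓ(R',T')`, `(I_n(R,T)).map φ ≤ I_n(R',T')` (`map_frobIdeal_le`,
  `map_levelIdeal_le`) and their pointwise forms `mapsTo_frobIdeal_smul_top`,
  `mapsTo_levelIdeal_smul_top` — so the level-`n` map `T/I_nT →+ T'/I_nT'` under ANY two
  presentations exists with NO side condition (`descend` applied to `mapsTo_levelIdeal_smul_top`);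
  `𝓛₀(T) ⊆ 𝓛₀(T')` (`degreeTwoPrimes_subset_degreeTwoPrimes`); and for `T` free over `R` (or the
  tree's `H0 R T`) the equalities `I_ℓ(R',T') = (I_ℓ(R,T)).map φ`, `I_n(R',T') = (I_n(R,T)).map φ`,
  the defining property of `I_ℓ(R',T')`, the unpacking of `𝓛_k(R',T')` and
  `𝓛_k(R,T) ⊆ 𝓛_k(R',T')` (`frobIdeal_eq_map_frobIdeal_of_free/_of_h0`,
  `levelIdeal_eq_map_levelIdeal_of_free/_of_h0`, `frobIdeal_mem_of_free/_of_h0`,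
  `mem_kolyvaginPrimes_iff_of_free`, `kolyvaginPrimes_subset_kolyvaginPrimes_of_free/_of_h0`).

All statements are over existing declarations of `SelmerTriples.lean` (`IsQuotientBy`,
`IsQuotientBy.transition`, `frobIdeal`, `kolyvaginPrimes`, `levelIdeal`, `degreeTwoPrimes`, `H0`).
No `instance`, no notation.  No summit statement is proved here; BSD is not proved by any of this.
-/

set_option autoImplicit false

noncomputable section

open Function NumberField IsDedekindDomain Field
open scoped NumberField ContRepresentation Classical

namespace Literature.NumberTheory.GaloisCohomology.Howard2004

open Literature.NumberTheory.GaloisRepresentations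
open Literature.NumberTheory.GaloisRepresentations.DiscreteGaloisModule

/-! ## 0. Pure algebra: where a `φ`-semilinear additive map sends `I • M` -/

section Algebra

variable {R : Type} [CommRing R] {R' : Type} [CommRing R'] {φ : R →+* R'}
  {M : Type} [AddCommGroup M] [Module R M] {M' : Type} [AddCommGroup M'] [Module R' M']

/-- An additive `f : M → M'` with `f (r • m) = φ r • f m` maps `I • M` into `I' • M'` whenever
`I ≤ I'.comap φ` (i.e. `φ(I) ⊆ I'`). [cite: Howard2004HeegnerKolyvagin, Def. 1.1.3 (arXiv Def. 2.1.3, p. 5, L93–99)] -/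
theorem mapsTo_smul_top_of_le_comap (f : M →+ M') (hf : ∀ (r : R) (m : M), f (r • m) = φ r • f m)
    {I : Ideal R} {I' : Ideal R'} (hII' : I ≤ I'.comap φ) :
    ∀ m ∈ (I • (⊤ : Submodule R M) : Submodule R M),
      f m ∈ (I' • (⊤ : Submodule R' M') : Submodule R' M') := by
  intro m hm
  refine Submodule.smul_induction_on hm (fun r hr n _ => ?_) (fun x y hx hy => ?_)
  · rw [hf]
    exact Submodule.smul_mem_smul (hII' hr) Submodule.mem_top
  · rw [map_add]
    exact Submodule.add_mem _ hx hy

/-- In particular `f (p^k M) ⊆ p^k M'` (any natural number `p`): `φ (p^k) = p^k`.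
[cite: Howard2004HeegnerKolyvagin, Def. 1.1.3 (arXiv Def. 2.1.3, p. 5, L93–99)] -/
theorem mapsTo_span_pow_smul_top (f : M →+ M') (hf : ∀ (r : R) (m : M), f (r • m) = φ r • f m)
    (p k : ℕ) :
    ∀ m ∈ ((Ideal.span {((p : ℕ) : R) ^ k}) • (⊤ : Submodule R M) : Submodule R M),
      f m ∈ ((Ideal.span {((p : ℕ) : R') ^ k}) • (⊤ : Submodule R' M') : Submodule R' M') := by
  refine mapsTo_smul_top_of_le_comap f hf ((Ideal.span_singleton_le_iff_mem _).mpr ?_)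
  rw [Ideal.mem_comap, map_pow, map_natCast]
  exact Ideal.mem_span_singleton_self _

/-- `f` kills `(ker φ) • M`. [cite: Howard2004HeegnerKolyvagin, Rem. 1.2.4 (arXiv Rem. 2.2.4, p. 7, L13–27)] -/
theorem map_eq_zero_of_mem_ker_smul_top (f : M →+ M')
    (hf : ∀ (r : R) (m : M), f (r • m) = φ r • f m) {m : M}
    (hm : m ∈ (RingHom.ker φ • (⊤ : Submodule R M) : Submodule R M)) : f m = 0 := by
  refine Submodule.smul_induction_on hm (fun r hr n _ => ?_) (fun x y hx hy => ?_)
  · rw [hf, RingHom.mem_ker.mp hr, zero_smul]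
  · rw [map_add, hx, hy, add_zero]

end Algebra

section Galois

variable {K : Type} [Field K] [NumberField K]
  {R : Type} [CommRing R] {R' : Type} [CommRing R']
  {M : Type} [AddCommGroup M] [TopologicalSpace M] [DiscreteTopology M] [Module R M]
  {M' : Type} [AddCommGroup M'] [TopologicalSpace M'] [DiscreteTopology M'] [Module R' M']
  {N : Type} [AddCommGroup N] [TopologicalSpace N] [DiscreteTopology N] [Module R N]
  {N' : Type} [AddCommGroup N'] [TopologicalSpace N'] [DiscreteTopology N'] [Module R' N']
  {ρ : DiscreteGaloisModule K M} {ρ' : DiscreteGaloisModule K M'}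
  {I : Ideal R} {I' : Ideal R'}
  {ρI : DiscreteGaloisModule K N} {ρI' : DiscreteGaloisModule K N'}
  {π : M →ₗ[R] N} {π' : M' →ₗ[R'] N'}

/-! ## 1. Descending an additive map `T → T'` to `T/IT → T'/I'T'` -/

namespace IsQuotientBy

omit [NumberField K] in
/-- The kernel inclusion behind `descend`: `f(IT) ⊆ I'T'` means `ker π ≤ ker (π' ∘ f)`.
[cite: Howard2004HeegnerKolyvagin, Def. 1.1.3 (arXiv Def. 2.1.3, p. 5, L93–99)] -/
theorem ker_le_ker_comp (hq : IsQuotientBy ρ I ρI π) (hq' : IsQuotientBy ρ' I' ρI' π')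
    (f : M →+ M')
    (hf : ∀ m ∈ (I • (⊤ : Submodule R M) : Submodule R M),
      f m ∈ (I' • (⊤ : Submodule R' M') : Submodule R' M')) :
    π.toAddMonoidHom.ker ≤ (π'.toAddMonoidHom.comp f).ker := by
  intro m hm
  rw [AddMonoidHom.mem_ker, LinearMap.toAddMonoidHom_coe, ← LinearMap.mem_ker, hq.ker_eq] at hm
  rw [AddMonoidHom.mem_ker, AddMonoidHom.comp_apply, LinearMap.toAddMonoidHom_coe,
    ← LinearMap.mem_ker, hq'.ker_eq]
  exact hf m hm

/-- **The morphism `T/IT → T'/I'T'` induced by an additive `f : T → T'` with `f(IT) ⊆ I'T'`**, on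
presentations `π : T ↠ N`, `π' : T' ↠ N'` (over possibly different coefficient rings `R`, `R'`):
the unique additive factorisation of `π' ∘ f` through `π`.  For `T' = T`, `f = id` this is
`IsQuotientBy.transition` (`descend_id_eq_transition`); along a change of coefficient ring it is the
map on Kolyvagin-system arguments `T^{(k)}/I_n → T'^{(k)}/I_n` underlying Howard's functoriality.
[cite: Howard2004HeegnerKolyvagin, Def. 1.1.3 and Rem. 1.2.4 (arXiv p. 5 L93–99, p. 7 L13–27)] -/
def descend (hq : IsQuotientBy ρ I ρI π) (hq' : IsQuotientBy ρ' I' ρI' π') (f : M →+ M')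
    (hf : ∀ m ∈ (I • (⊤ : Submodule R M) : Submodule R M),
      f m ∈ (I' • (⊤ : Submodule R' M') : Submodule R' M')) : N →+ N' :=
  π.toAddMonoidHom.liftOfRightInverse (Function.surjInv hq.surjective)
    (Function.rightInverse_surjInv hq.surjective)
    ⟨π'.toAddMonoidHom.comp f, hq.ker_le_ker_comp hq' f hf⟩

omit [NumberField K] in
/-- `descend` is compatible with the two presentations: `descend (π m) = π' (f m)`.
[cite: Howard2004HeegnerKolyvagin, Def. 1.1.3 (arXiv Def. 2.1.3, p. 5, L95–97)] -/
theorem descend_apply (hq : IsQuotientBy ρ I ρI π) (hq' : IsQuotientBy ρ' I' ρI' π') (f : M →+ M')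
    (hf : ∀ m ∈ (I • (⊤ : Submodule R M) : Submodule R M),
      f m ∈ (I' • (⊤ : Submodule R' M') : Submodule R' M')) (m : M) :
    hq.descend hq' f hf (π m) = π' (f m) :=
  AddMonoidHom.liftOfRightInverse_comp_apply π.toAddMonoidHom (Function.surjInv hq.surjective)
    (Function.rightInverse_surjInv hq.surjective)
    ⟨π'.toAddMonoidHom.comp f, hq.ker_le_ker_comp hq' f hf⟩ m

omit [NumberField K] in
/-- Two additive maps out of a presentation `π : T ↠ N` that agree on `π(T)` are equal.
[cite: Howard2004HeegnerKolyvagin, Def. 1.1.3 (arXiv Def. 2.1.3, p. 5, L93–99)] -/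
theorem addMonoidHom_ext (hq : IsQuotientBy ρ I ρI π) {X : Type} [AddZeroClass X]
    {g₁ g₂ : N →+ X} (h : ∀ m : M, g₁ (π m) = g₂ (π m)) : g₁ = g₂ :=
  AddMonoidHom.ext fun x => by
    obtain ⟨m, rfl⟩ := hq.surjective x
    exact h m

omit [NumberField K] in
/-- **Uniqueness**: any additive `g` with `g ∘ π = π' ∘ f` is `descend`.
[cite: Howard2004HeegnerKolyvagin, Def. 1.1.3 (arXiv Def. 2.1.3, p. 5, L95–97)] -/
theorem descend_unique (hq : IsQuotientBy ρ I ρI π) (hq' : IsQuotientBy ρ' I' ρI' π') (f : M →+ M')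
    (hf : ∀ m ∈ (I • (⊤ : Submodule R M) : Submodule R M),
      f m ∈ (I' • (⊤ : Submodule R' M') : Submodule R' M'))
    {g : N →+ N'} (hg : ∀ m : M, g (π m) = π' (f m)) : g = hq.descend hq' f hf :=
  hq.addMonoidHom_ext fun m => by rw [hg, descend_apply]

omit [NumberField K] in
/-- **Existence criterion**: an additive map `g : N → N'` with `g ∘ π = π' ∘ f` exists iff
`f(IT) ⊆ I'T'`. [cite: Howard2004HeegnerKolyvagin, Def. 1.1.3 (arXiv Def. 2.1.3, p. 5, L93–99)] -/
theorem exists_addMonoidHom_iff (hq : IsQuotientBy ρ I ρI π) (hq' : IsQuotientBy ρ' I' ρI' π')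
    (f : M →+ M') :
    (∃ g : N →+ N', ∀ m : M, g (π m) = π' (f m)) ↔
      ∀ m ∈ (I • (⊤ : Submodule R M) : Submodule R M),
        f m ∈ (I' • (⊤ : Submodule R' M') : Submodule R' M') := by
  constructor
  · rintro ⟨g, hg⟩ m hm
    rw [← hq'.ker_eq, LinearMap.mem_ker, ← hg]
    rw [← hq.ker_eq, LinearMap.mem_ker] at hm
    rw [hm, map_zero]
  · exact fun hf => ⟨hq.descend hq' f hf, hq.descend_apply hq' f hf⟩

omit [NumberField K] in
/-- `descend` is `Γ_K`-equivariant when `f` is. [cite: Howard2004HeegnerKolyvagin, Def. 1.1.3 (arXiv Def. 2.1.3, p. 5, L95–97)] -/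
theorem descend_equivariant (hq : IsQuotientBy ρ I ρI π) (hq' : IsQuotientBy ρ' I' ρI' π')
    (f : M →+ M')
    (hf : ∀ m ∈ (I • (⊤ : Submodule R M) : Submodule R M),
      f m ∈ (I' • (⊤ : Submodule R' M') : Submodule R' M'))
    (hρ : ∀ (σ : absoluteGaloisGroup K) (m : M), f (ρ σ m) = ρ' σ (f m))
    (σ : absoluteGaloisGroup K) (x : N) :
    hq.descend hq' f hf (ρI σ x) = ρI' σ (hq.descend hq' f hf x) := by
  obtain ⟨m, rfl⟩ := hq.surjective x
  rw [← hq.equivariant, descend_apply, descend_apply, hρ, hq'.equivariant]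

omit [NumberField K] in
/-- `descend` is `φ`-semilinear when `f` is. [cite: Howard2004HeegnerKolyvagin, Def. 1.1.3 and Rem. 1.2.4 (arXiv p. 5 L95–97, p. 7 L13–27)] -/
theorem descend_smul (hq : IsQuotientBy ρ I ρI π) (hq' : IsQuotientBy ρ' I' ρI' π') (f : M →+ M')
    (hf : ∀ m ∈ (I • (⊤ : Submodule R M) : Submodule R M),
      f m ∈ (I' • (⊤ : Submodule R' M') : Submodule R' M'))
    {φ : R →+* R'} (hφ : ∀ (r : R) (m : M), f (r • m) = φ r • f m) (r : R) (x : N) :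
    hq.descend hq' f hf (r • x) = φ r • hq.descend hq' f hf x := by
  obtain ⟨m, rfl⟩ := hq.surjective x
  rw [← map_smul π r m, descend_apply, descend_apply, hφ, map_smul π']

omit [NumberField K] in
/-- For `T' = T`, `f = id`, `I ≤ J`: `descend` is the transition map `T/IT → T/JT`.
[cite: Howard2004HeegnerKolyvagin, Def. 1.1.3 (arXiv Def. 2.1.3, p. 5, L95–97)] -/
theorem descend_id_eq_transition {J : Ideal R} {P : Type} [AddCommGroup P] [TopologicalSpace P]
    [DiscreteTopology P] [Module R P] {ρJ : DiscreteGaloisModule K P} {πJ : M →ₗ[R] P}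
    (hq : IsQuotientBy ρ I ρI π) (hqJ : IsQuotientBy ρ J ρJ πJ) (hIJ : I ≤ J)
    (hf : ∀ m ∈ (I • (⊤ : Submodule R M) : Submodule R M),
      AddMonoidHom.id M m ∈ (J • (⊤ : Submodule R M) : Submodule R M)) (x : N) :
    hq.descend hqJ (AddMonoidHom.id M) hf x = hq.transition hqJ hIJ x := by
  obtain ⟨m, rfl⟩ := hq.surjective x
  rw [descend_apply, transition_apply, AddMonoidHom.id_apply]

omit [NumberField K] in
/-- **`descend` commutes with the stage transitions**: for `I ≤ J` in `R`, `I' ≤ J'` in `R'` and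
`f(IT) ⊆ I'T'`, `f(JT) ⊆ J'T'`, the square `T/IT → T'/I'T' → T'/J'T'` = `T/IT → T/JT → T'/J'T'`
commutes. [cite: Howard2004HeegnerKolyvagin, Def. 1.1.3 and Def. 1.2.3 (arXiv p. 5 L95–97, p. 7 L1–12)] -/
theorem descend_transition {J : Ideal R} {J' : Ideal R'}
    {P : Type} [AddCommGroup P] [TopologicalSpace P] [DiscreteTopology P] [Module R P]
    {P' : Type} [AddCommGroup P'] [TopologicalSpace P'] [DiscreteTopology P'] [Module R' P']
    {ρJ : DiscreteGaloisModule K P} {ρJ' : DiscreteGaloisModule K P'}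
    {πJ : M →ₗ[R] P} {πJ' : M' →ₗ[R'] P'}
    (hqI : IsQuotientBy ρ I ρI π) (hqJ : IsQuotientBy ρ J ρJ πJ) (hIJ : I ≤ J)
    (hqI' : IsQuotientBy ρ' I' ρI' π') (hqJ' : IsQuotientBy ρ' J' ρJ' πJ') (hI'J' : I' ≤ J')
    (f : M →+ M')
    (hfI : ∀ m ∈ (I • (⊤ : Submodule R M) : Submodule R M),
      f m ∈ (I' • (⊤ : Submodule R' M') : Submodule R' M'))
    (hfJ : ∀ m ∈ (J • (⊤ : Submodule R M) : Submodule R M),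
      f m ∈ (J' • (⊤ : Submodule R' M') : Submodule R' M')) (x : N) :
    hqJ.descend hqJ' f hfJ (hqI.transition hqJ hIJ x) =
      hqI'.transition hqJ' hI'J' (hqI.descend hqI' f hfI x) := by
  obtain ⟨m, rfl⟩ := hqI.surjective x
  rw [transition_apply, descend_apply, descend_apply, transition_apply]

omit [NumberField K] in
/-- **`descend` composes**: along `T → T' → T''` the descended maps compose to the descended map of
the composite. [cite: Howard2004HeegnerKolyvagin, Def. 1.1.3 and Rem. 1.2.4 (arXiv p. 5 L95–97, p. 7 L13–27)] -/
theorem descend_comp {R'' : Type} [CommRing R''] {M'' : Type} [AddCommGroup M'']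
    [TopologicalSpace M''] [DiscreteTopology M''] [Module R'' M''] {N'' : Type} [AddCommGroup N'']
    [TopologicalSpace N''] [DiscreteTopology N''] [Module R'' N''] {ρ'' : DiscreteGaloisModule K M''}
    {I'' : Ideal R''} {ρI'' : DiscreteGaloisModule K N''} {π'' : M'' →ₗ[R''] N''}
    (hq : IsQuotientBy ρ I ρI π) (hq' : IsQuotientBy ρ' I' ρI' π')
    (hq'' : IsQuotientBy ρ'' I'' ρI'' π'') (f : M →+ M') (g : M' →+ M'')
    (hf : ∀ m ∈ (I • (⊤ : Submodule R M) : Submodule R M),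
      f m ∈ (I' • (⊤ : Submodule R' M') : Submodule R' M'))
    (hg : ∀ m' ∈ (I' • (⊤ : Submodule R' M') : Submodule R' M'),
      g m' ∈ (I'' • (⊤ : Submodule R'' M'') : Submodule R'' M'')) (x : N) :
    hq'.descend hq'' g hg (hq.descend hq' f hf x) =
      hq.descend hq'' (g.comp f) (fun m hm => hg _ (hf m hm)) x := by
  obtain ⟨m, rfl⟩ := hq.surjective x
  rw [descend_apply, descend_apply, descend_apply, AddMonoidHom.comp_apply]

end IsQuotientBy

/-! ## 2. Semilinear base change `T ↠ T' = T ⊗_R R'` along `φ : R ↠ R'` -/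

/-- **`f` presents the base change `T' = T ⊗_R R'` along `φ`** (instance-free): `φ : R → R'` and the
additive `f : T → T'` are surjective, `f` is `φ`-semilinear and `Γ_K`-equivariant, and `ker f ⊆ (ker φ)T`
(the reverse inclusion is automatic, `map_eq_zero_iff`).  For `φ : R ↠ R/J` this is Howard's
`T ↦ T ⊗_R R/J = T/JT` of Rem. 1.2.4; the levels of a tower morphism
`𝐓/J𝐓 ↠ 𝐓/J'𝐓` (`J ⊆ J'`) are instances.
[cite: Howard2004HeegnerKolyvagin, Rem. 1.2.4 (arXiv Rem. 2.2.4, p. 7, L13–27)] -/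
structure IsBaseChangeBy (ρ : DiscreteGaloisModule K M) (φ : R →+* R')
    (ρ' : DiscreteGaloisModule K M') (f : M →+ M') : Prop where
  ringHom_surjective : Function.Surjective φ
  surjective : Function.Surjective f
  map_smul : ∀ (r : R) (m : M), f (r • m) = φ r • f m
  ker_le : ∀ m : M, f m = 0 → m ∈ (RingHom.ker φ • (⊤ : Submodule R M) : Submodule R M)
  equivariant : ∀ (σ : absoluteGaloisGroup K) (m : M), f (ρ σ m) = ρ' σ (f m)

namespace IsBaseChangeBy

variable {φ : R →+* R'} {f : M →+ M'}

omit [NumberField K] in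
/-- `ker f = (ker φ)T`. [cite: Howard2004HeegnerKolyvagin, Rem. 1.2.4 (arXiv Rem. 2.2.4, p. 7, L13–27)] -/
theorem map_eq_zero_iff (h : IsBaseChangeBy ρ φ ρ' f) (m : M) :
    f m = 0 ↔ m ∈ (RingHom.ker φ • (⊤ : Submodule R M) : Submodule R M) :=
  ⟨h.ker_le m, map_eq_zero_of_mem_ker_smul_top f h.map_smul⟩

omit [NumberField K] in
/-- Viewing `T'` as an `R`-module through `φ` (inside proofs only), `f` is an `R`-linear
presentation of `T/(ker φ)T` in the sense of `IsQuotientBy`.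
[cite: Howard2004HeegnerKolyvagin, Def. 1.1.3 and Rem. 1.2.4 (arXiv p. 5 L93–99, p. 7 L13–27)] -/
theorem exists_isQuotientBy (h : IsBaseChangeBy ρ φ ρ' f) :
    letI : Module R M' := Module.compHom M' φ
    ∃ fR : M →ₗ[R] M', IsQuotientBy ρ (RingHom.ker φ) ρ' fR ∧ ∀ m : M, fR m = f m := by
  letI : Module R M' := Module.compHom M' φ
  refine ⟨{ toFun := f, map_add' := f.map_add, map_smul' := fun r m => ?_ }, ?_, fun _ => rfl⟩
  · rw [RingHom.id_apply]
    exact h.map_smul r m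
  · exact
      { surjective := h.surjective
        ker_eq := by
          ext m
          rw [LinearMap.mem_ker]
          exact h.map_eq_zero_iff m
        equivariant := h.equivariant }

/-- **ALWAYS `(I_ℓ(R, T)).map φ ≤ I_ℓ(R', T')`.**
[cite: Howard2004HeegnerKolyvagin, Def. 1.2.1 and Rem. 1.2.4 (arXiv p. 6 L63–66, p. 7 L13–27)] -/
theorem map_frobIdeal_le (h : IsBaseChangeBy ρ φ ρ' f) (v : HeightOneSpectrum (𝓞 K)) :
    (frobIdeal (R := R) ρ v).map φ ≤ frobIdeal (R := R') ρ' v := by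
  letI : Algebra R R' := φ.toAlgebra
  letI : Module R M' := Module.compHom M' φ
  haveI : IsScalarTower R R' M' := IsScalarTower.of_algebraMap_smul fun _ _ => rfl
  obtain ⟨fR, hQ, -⟩ := h.exists_isQuotientBy
  exact hQ.map_frobIdeal_le le_rfl h.ringHom_surjective v

/-- Pointwise form: `f (I_ℓ(R,T)•T) ⊆ I_ℓ(R',T')•T'`, so `T/I_ℓT →+ T'/I_ℓT'` descends under any two
presentations (`IsQuotientBy.descend`). [cite: Howard2004HeegnerKolyvagin, Def. 1.2.1 and Rem. 1.2.4 (arXiv p. 6 L63–66, p. 7 L13–27)] -/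
theorem mapsTo_frobIdeal_smul_top (h : IsBaseChangeBy ρ φ ρ' f) (v : HeightOneSpectrum (𝓞 K)) :
    ∀ m ∈ (frobIdeal (R := R) ρ v • (⊤ : Submodule R M) : Submodule R M),
      f m ∈ (frobIdeal (R := R') ρ' v • (⊤ : Submodule R' M') : Submodule R' M') :=
  mapsTo_smul_top_of_le_comap f h.map_smul (Ideal.map_le_iff_le_comap.mp (h.map_frobIdeal_le v))

/-- **ALWAYS `(I_n(R, T)).map φ ≤ I_n(R', T')`** — the level-ideal inclusion `φ(I_n(T)) ⊆ I_n(T')`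
under which the quotient-level maps of a tower morphism exist.
[cite: Howard2004HeegnerKolyvagin, Def. 1.2.1 and Rem. 1.2.4 (arXiv p. 6 L73–75, p. 7 L13–27)] -/
theorem map_levelIdeal_le (h : IsBaseChangeBy ρ φ ρ' f) (n : Finset (HeightOneSpectrum (𝓞 K))) :
    (levelIdeal (R := R) ρ n).map φ ≤ levelIdeal (R := R') ρ' n := by
  letI : Algebra R R' := φ.toAlgebra
  letI : Module R M' := Module.compHom M' φ
  haveI : IsScalarTower R R' M' := IsScalarTower.of_algebraMap_smul fun _ _ => rfl
  obtain ⟨fR, hQ, -⟩ := h.exists_isQuotientBy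
  exact hQ.map_levelIdeal_le le_rfl h.ringHom_surjective n

/-- Pointwise form: `f (I_n(R,T)•T) ⊆ I_n(R',T')•T'` — the hypothesis of `IsQuotientBy.descend` for
the level-`n` Kolyvagin quotients, with NO freeness or side condition: for any presentations
`πq : T ↠ T/I_n(R,T)T`, `πq' : T' ↠ T'/I_n(R',T')T'`,
`hq.descend hq' f (h.mapsTo_levelIdeal_smul_top n)` is THE map `T/I_nT →+ T'/I_nT'` over `f`.
[cite: Howard2004HeegnerKolyvagin, Def. 1.2.3 and Rem. 1.2.4 (arXiv p. 7 L1–12, L13–27)] -/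
theorem mapsTo_levelIdeal_smul_top (h : IsBaseChangeBy ρ φ ρ' f)
    (n : Finset (HeightOneSpectrum (𝓞 K))) :
    ∀ m ∈ (levelIdeal (R := R) ρ n • (⊤ : Submodule R M) : Submodule R M),
      f m ∈ (levelIdeal (R := R') ρ' n • (⊤ : Submodule R' M') : Submodule R' M') :=
  mapsTo_smul_top_of_le_comap f h.map_smul (Ideal.map_le_iff_le_comap.mp (h.map_levelIdeal_le n))

omit [NumberField K] in
/-- **`𝓛₀(T) ⊆ 𝓛₀(T')`**: `T'` is unramified where `T` is.
[cite: Howard2004HeegnerKolyvagin, §1.2 (arXiv p. 6, L54–56)] -/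
theorem degreeTwoPrimes_subset_degreeTwoPrimes (h : IsBaseChangeBy ρ φ ρ' f) (p : ℕ) :
    degreeTwoPrimes p ρ ⊆ degreeTwoPrimes p ρ' := by
  letI : Module R M' := Module.compHom M' φ
  obtain ⟨fR, hQ, -⟩ := h.exists_isQuotientBy
  exact hQ.degreeTwoPrimes_subset_degreeTwoPrimes p

/-- **`I_ℓ(R', T') = (I_ℓ(R, T)).map φ` for `T` free over `R`.**
[cite: Howard2004HeegnerKolyvagin, Def. 1.2.1, Rem. 1.2.4 and H.0 (arXiv p. 6 L63–66, p. 7)] -/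
theorem frobIdeal_eq_map_frobIdeal_of_free [Module.Free R M] (h : IsBaseChangeBy ρ φ ρ' f)
    (v : HeightOneSpectrum (𝓞 K)) :
    frobIdeal (R := R') ρ' v = (frobIdeal (R := R) ρ v).map φ := by
  letI : Algebra R R' := φ.toAlgebra
  letI : Module R M' := Module.compHom M' φ
  haveI : IsScalarTower R R' M' := IsScalarTower.of_algebraMap_smul fun _ _ => rfl
  obtain ⟨fR, hQ, -⟩ := h.exists_isQuotientBy
  exact hQ.frobIdeal_eq_map_frobIdeal_of_free le_rfl h.ringHom_surjective v

/-- H.0 by name: `I_ℓ(R', T') = (I_ℓ(R, T)).map φ` under the tree's `H0 R T`.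
[cite: Howard2004HeegnerKolyvagin, Def. 1.2.1, Rem. 1.2.4 and H.0 (arXiv p. 6 L63–66, p. 7)] -/
theorem frobIdeal_eq_map_frobIdeal_of_h0 (h0 : H0 R M) (h : IsBaseChangeBy ρ φ ρ' f)
    (v : HeightOneSpectrum (𝓞 K)) :
    frobIdeal (R := R') ρ' v = (frobIdeal (R := R) ρ v).map φ := by
  haveI := h0.1
  exact h.frobIdeal_eq_map_frobIdeal_of_free v

/-- **The defining property of `I_ℓ(R', T')`** for `T` free over `R`: `ℓ+1 ∈ I_ℓ(R', T')` and
`Frob_λ ≡ 1 (mod I_ℓ(R', T')•T')` — although `T'` is only free over `R'`, not over `R`.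
[cite: Howard2004HeegnerKolyvagin, Def. 1.2.1, Rem. 1.2.4 and H.0 (arXiv p. 6 L63–66, p. 7)] -/
theorem frobIdeal_mem_of_free [Module.Free R M] (h : IsBaseChangeBy ρ φ ρ' f)
    (v : HeightOneSpectrum (𝓞 K)) :
    ((residueChar v + 1 : ℕ) : R') ∈ frobIdeal (R := R') ρ' v ∧
      ∀ σ : absoluteGaloisGroup K, IsArithFrobAtPlace K v σ →
        ∀ x : M', ρ' σ x - x ∈ (frobIdeal (R := R') ρ' v • (⊤ : Submodule R' M') : Submodule R' M') := by
  letI : Algebra R R' := φ.toAlgebra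
  letI : Module R M' := Module.compHom M' φ
  haveI : IsScalarTower R R' M' := IsScalarTower.of_algebraMap_smul fun _ _ => rfl
  obtain ⟨fR, hQ, -⟩ := h.exists_isQuotientBy
  exact hQ.frobIdeal_mem_ringChange_of_free le_rfl h.ringHom_surjective v

/-- H.0 by name: the defining property of `I_ℓ(R', T')` under the tree's `H0 R T`.
[cite: Howard2004HeegnerKolyvagin, Def. 1.2.1, Rem. 1.2.4 and H.0 (arXiv p. 6 L63–66, p. 7)] -/
theorem frobIdeal_mem_of_h0 (h0 : H0 R M) (h : IsBaseChangeBy ρ φ ρ' f)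
    (v : HeightOneSpectrum (𝓞 K)) :
    ((residueChar v + 1 : ℕ) : R') ∈ frobIdeal (R := R') ρ' v ∧
      ∀ σ : absoluteGaloisGroup K, IsArithFrobAtPlace K v σ →
        ∀ x : M', ρ' σ x - x ∈ (frobIdeal (R := R') ρ' v • (⊤ : Submodule R' M') : Submodule R' M') := by
  haveI := h0.1
  exact h.frobIdeal_mem_of_free v

/-- **`𝓛_k(R', T')` unpacked** for `T` free over `R`: `λ ∈ 𝓛_k(R', T')` iff `λ ∈ 𝓛₀(T')`,
`ℓ+1 ∈ p^k R'` and `Frob_λ ≡ 1 (mod p^k T')`.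
[cite: Howard2004HeegnerKolyvagin, Def. 1.2.1 (arXiv p. 6, L67–68)] -/
theorem mem_kolyvaginPrimes_iff_of_free [Module.Free R M] (h : IsBaseChangeBy ρ φ ρ' f)
    (p k : ℕ) (v : HeightOneSpectrum (𝓞 K)) :
    v ∈ kolyvaginPrimes (R := R') p ρ' k ↔
      (v ∈ degreeTwoPrimes p ρ' ∧
        ((residueChar v + 1 : ℕ) : R') ∈ Ideal.span {((p : ℕ) : R') ^ k} ∧
        ∀ σ : absoluteGaloisGroup K, IsArithFrobAtPlace K v σ →
          ∀ x : M', ρ' σ x - x ∈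
            ((Ideal.span {((p : ℕ) : R') ^ k}) • (⊤ : Submodule R' M') : Submodule R' M')) :=
  mem_kolyvaginPrimes_iff_of_mem p ρ' k v (h.frobIdeal_mem_of_free v)

/-- **`I_n(R', T') = (I_n(R, T)).map φ` for `T` free over `R`.**
[cite: Howard2004HeegnerKolyvagin, Def. 1.2.1, Rem. 1.2.4 and H.0 (arXiv p. 6 L73–75, p. 7)] -/
theorem levelIdeal_eq_map_levelIdeal_of_free [Module.Free R M] (h : IsBaseChangeBy ρ φ ρ' f)
    (n : Finset (HeightOneSpectrum (𝓞 K))) :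
    levelIdeal (R := R') ρ' n = (levelIdeal (R := R) ρ n).map φ := by
  letI : Algebra R R' := φ.toAlgebra
  letI : Module R M' := Module.compHom M' φ
  haveI : IsScalarTower R R' M' := IsScalarTower.of_algebraMap_smul fun _ _ => rfl
  obtain ⟨fR, hQ, -⟩ := h.exists_isQuotientBy
  exact hQ.levelIdeal_eq_map_levelIdeal_of_free le_rfl h.ringHom_surjective n

/-- H.0 by name: `I_n(R', T') = (I_n(R, T)).map φ` under the tree's `H0 R T`.
[cite: Howard2004HeegnerKolyvagin, Def. 1.2.1, Rem. 1.2.4 and H.0 (arXiv p. 6 L73–75, p. 7)] -/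
theorem levelIdeal_eq_map_levelIdeal_of_h0 (h0 : H0 R M) (h : IsBaseChangeBy ρ φ ρ' f)
    (n : Finset (HeightOneSpectrum (𝓞 K))) :
    levelIdeal (R := R') ρ' n = (levelIdeal (R := R) ρ n).map φ := by
  haveI := h0.1
  exact h.levelIdeal_eq_map_levelIdeal_of_free n

/-- **`𝓛_k(R, T) ⊆ 𝓛_k(R', T')` for `T` free over `R`** — the Kolyvagin primes of the source
level are Kolyvagin primes of the target level (the ingredient of `LargePrimes` transport along a
tower morphism). [cite: Howard2004HeegnerKolyvagin, Def. 1.2.1, Rem. 1.2.4 and H.0 (arXiv p. 6 L67–68, p. 7)] -/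
theorem kolyvaginPrimes_subset_kolyvaginPrimes_of_free [Module.Free R M]
    (h : IsBaseChangeBy ρ φ ρ' f) (p k : ℕ) :
    kolyvaginPrimes (R := R) p ρ k ⊆ kolyvaginPrimes (R := R') p ρ' k := by
  letI : Algebra R R' := φ.toAlgebra
  letI : Module R M' := Module.compHom M' φ
  haveI : IsScalarTower R R' M' := IsScalarTower.of_algebraMap_smul fun _ _ => rfl
  obtain ⟨fR, hQ, -⟩ := h.exists_isQuotientBy
  exact hQ.kolyvaginPrimes_subset_kolyvaginPrimes_ringChange_of_free p k

/-- H.0 by name: `𝓛_k(R, T) ⊆ 𝓛_k(R', T')` under the tree's `H0 R T`.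
[cite: Howard2004HeegnerKolyvagin, Def. 1.2.1, Rem. 1.2.4 and H.0 (arXiv p. 6 L67–68, p. 7)] -/
theorem kolyvaginPrimes_subset_kolyvaginPrimes_of_h0 (h0 : H0 R M) (h : IsBaseChangeBy ρ φ ρ' f)
    (p k : ℕ) :
    kolyvaginPrimes (R := R) p ρ k ⊆ kolyvaginPrimes (R := R') p ρ' k := by
  haveI := h0.1
  exact h.kolyvaginPrimes_subset_kolyvaginPrimes_of_free p k

/-- **The level-`n` map of Kolyvagin quotients over a base change is `Γ_K`-equivariant and
`φ`-semilinear** (packaging `descend_equivariant` / `descend_smul` with the automatic hypothesis).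
[cite: Howard2004HeegnerKolyvagin, Def. 1.2.3 and Rem. 1.2.4 (arXiv p. 7 L1–12, L13–27)] -/
theorem descend_levelIdeal_equivariant_smul (h : IsBaseChangeBy ρ φ ρ' f)
    (n : Finset (HeightOneSpectrum (𝓞 K)))
    (hq : IsQuotientBy ρ (levelIdeal (R := R) ρ n) ρI π)
    (hq' : IsQuotientBy ρ' (levelIdeal (R := R') ρ' n) ρI' π') :
    (∀ (σ : absoluteGaloisGroup K) (x : N),
        hq.descend hq' f (h.mapsTo_levelIdeal_smul_top n) (ρI σ x) =
          ρI' σ (hq.descend hq' f (h.mapsTo_levelIdeal_smul_top n) x)) ∧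
      ∀ (r : R) (x : N), hq.descend hq' f (h.mapsTo_levelIdeal_smul_top n) (r • x) =
        φ r • hq.descend hq' f (h.mapsTo_levelIdeal_smul_top n) x :=
  ⟨hq.descend_equivariant hq' f _ h.equivariant, hq.descend_smul hq' f _ h.map_smul⟩

omit [NumberField K] in
/-- Surjectivity of the descended map over a base change (`f` surjective ⇒ `descend` surjective).
[cite: Howard2004HeegnerKolyvagin, Def. 1.2.3 and Rem. 1.2.4 (arXiv p. 7 L1–12, L13–27)] -/
theorem descend_surjective (h : IsBaseChangeBy ρ φ ρ' f)
    (hq : IsQuotientBy ρ I ρI π) (hq' : IsQuotientBy ρ' I' ρI' π')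
    (hf : ∀ m ∈ (I • (⊤ : Submodule R M) : Submodule R M),
      f m ∈ (I' • (⊤ : Submodule R' M') : Submodule R' M')) :
    Function.Surjective (hq.descend hq' f hf) := by
  intro y
  obtain ⟨m', rfl⟩ := hq'.surjective y
  obtain ⟨m, rfl⟩ := h.surjective m'
  exact ⟨π m, hq.descend_apply hq' f hf m⟩

end IsBaseChangeBy

end Galois

end Literature.NumberTheory.GaloisCohomology.Howard2004
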